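import Literature.MathematicalPhysics.QuantumFieldTheory.Balaban1983to89.Beta.RemainderDecay190Periodised
import Literature.MathematicalPhysics.QuantumFieldTheory.Balaban1983to89.B11SupSize190

/-!
# [Balaban1987RG1] p. 282 ⟵ [Balaban1985Variational] (190): NODE D's socket `Data190` INHABITED ON THE TWO-GRID
CARRIER — B-data on one finite point set, configurations on ANOTHER, both fibred over the unit cube-torus; complex
values; the sup sizes of (190) over the M-cubes (`Beta.RemainderDecay190TwoGrid`)

HONEST FRAMING (cell rule, page 1 of everything).  Discharging `BetaPertH` makes Bałaban's UV stability UNCONDITIONAL —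
a real constructive-QFT result; it is NOT the continuum limit and NOT the Clay problem.  This module discharges NOTHING
of `BetaPertH`.  It is CARRIER PLUMBING for row (D4) of the wall (`RemainderConst` ⇐ the (β) leaves): the (190)-socket
`RemainderDecay190.Data190` of the k-uniform remainder chain (NODE D) is inhabited on a carrier general enough to host
Bałaban's own one-step operators, which map functions on the UNIT lattice (the B-data, [I] p. 282: *"the functions
B_i"*) to functions on the FINE η-lattice (the configurations, [I] (4.4)): e.g. the flat linearized minimizer
`H_k : (T₁ × {1..d} → ℂ) → (T_η × {1..d} → ℂ)` of [Balaban1984PropagatorsI] (1.59)–(1.63) (the tree's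
`B5Hk163Torus.HkOp`).  Generations 93–96 of this lineage inhabited the socket only on the SAME-torus scalar model
(`RemainderDecay190Periodised.exists_data190_of_entry_cubes_supNorm`: B-data = configurations = real functions on the
unit cube-torus), which cannot host a coarse-to-fine operator (memo `HOME/b2b-balaban-beta-an4/FLAT-LETTERS-LOCATED.md`
§9 R7 of generation 100).  Bookkeeping-grade; NOT summit progress.

ABSOLUTE RULE (cell).  "No internally-minted statement may enter as a cited fact. Every hypothesis is either
kernel-proved in this package or a verbatim quotation of a PUBLISHED theorem with page reference. The manuscript(s)
under audit are NOT citable for their own disputed steps — they are the thing under adjudication; programme-internal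
(2001/route/tribunal) claims are never citable."  Every declaration below is a proved theorem; no `def` is introduced.

CITATION HEADER (lean-in-tree rule 2026-08-18).  [I] = T. Bałaban, *Renormalization group approach to lattice gauge
field theories. I*, Commun. Math. Phys. **109**, 249–301 (1987) [Balaban1987RG1] (held
`paper:balaban1987-cmp109-rg-i-small-field`; PDF page = journal page − 248): p. 282 (the decay of (δ/δB)𝐇_j(□₀,0),
*"can be estimated by B₃∏_{i∈N(p)}∣B_i∣, and if one of the functions B_i is localized outside the domain X, then we have
the additional exponential factor exp(−δ₀dist^{(ξ)}(X, supp B_i))"*), (4.4) p. 281 (*"max{∣𝐀∣_X, ∣P₁(□₀)𝐀∣_X,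
∣∇^ξ𝐀∣_X, ∣Δ^ξ𝐀∣_X} < α₂"* — sup-norms over X), §0 p. 257 (cubes of side M of the unit lattice, localization domains
= unions of cubes); [15] = T. Bałaban, *The variational problem and background fields in renormalization group method
for lattice gauge theories*, Commun. Math. Phys. **102**, 277–309 (1985) [Balaban1985Variational], (190) p. 308 (*"…
≤ O(1)[…]·(L^{j′}η)^{−d} exp(−⅛δ₀d(y,y′)) (190) for x ∈ Δ(y), … y ∈ Λ_j, y′ ∈ Λ_{j′}"* — the bound is BLOCK BY BLOCK,
a sup over the fine points x of the block Δ(y) against B-data localised in the block of y′); [3] = T. Bałaban,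
*Propagators and renormalization transformations for lattice gauge theories. II*, Commun. Math. Phys. **96**, 223–250
(1984) [Balaban1984PropagatorsII], (2.46) p. 231 (the block distance d(y,y′)), (2.51)–(2.52) p. 232 (*"|(Tλ)(x)| ≤
K(y, y′)|λ|, x ∈ B(y), supp λ ⊂ B(y′)"*, *"Σ_y Δ(y) = I"*), Lemma 2.1 (2.61) p. 234; [B5] = T. Bałaban, *Propagators
and renormalization transformations for lattice gauge theories. I*, Commun. Math. Phys. **95**, 17–40 (1984)
[Balaban1984PropagatorsI], (1.6) p. 18 (*"we divide T₁ into blocks B(y) parametrized by the points of T_L^{(1)}"* — the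
fibration of the fine lattice over the coarse one), (1.59)–(1.63) pp. 27–28 (H_k).  The quotations were read on the
300-dpi renders `HOME/b2b-balaban-ref1/pages/1987-cmp109-rg-I-small-field/…-p034-x2.png` ([I] p. 282) and
`…/1985-cmp102-variational-background/…-p032-x2.png` ([15] p. 308) by generation 12 of this unit and agree letter for
letter with the wordings certified in `B12Decay510FromB11` (unit b03-g4) and `B11SectG` (lit-balaban r08).

## The carrier (THE TWO-GRID MODEL)

Per volume index n (tori with `N n` cubes of side `M` per direction; dimension `D`):
* block geometry 𝔅_n := the cube torus read in `Π_i Fin (N n)` through the canonical identification ê (an isometry for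
  the periodic ℓ¹ distances, generation 93 `RemainderDecay190Dictionary.tdist1_finOfVal_eq_pl1`), packaged as the
  `toB6 (torusGeom …)` site-torus geometry of `RemainderRowSum` §5 (d(y,y′) = `tdist1`, every block of scale 0; the
  weights `η L Mg R H` of the geometry record are free parameters, unread by the sup sizes);
* B-data := complex functions on a finite point set `XB n` FIBRED over the unit cube-torus `TPt D (N n·M)` by
  `baseB n : XB n → TPt D (N n·M)` (for `H_k`: `XB n = T₁ × {1..D}`, `baseB = Prod.fst`), with the SUP SIZE of (190)
  over the fibres of the cubes (`B11SupSize190.supSize`, box of y = {b : ê(cube(baseB b)) = y}, sharp cut along the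
  same block map); fibre multiplicity ≤ m (`hm`; for `H_k`: m = D);
* configurations := complex functions on a finite point set `XA n` fibred over the same unit torus by `baseA n`
  (for `H_k`: `XA n = T_η × {1..D}`, `baseA = blockOf ∘ Prod.fst`, the coarse point under a fine point, [B5] (1.6)),
  with the sup size over the fibres of the cubes — ONE local size for every index i ∈ I of the (4.4)-functional;
* (4.4)-space `Wn n := XA n → ℂ` with the sup norm; identification ι_X̄ := restriction to the configuration points over
  the cubes of X̄ (zero elsewhere); blocks meeting X̄ := ê''(cubes of X̄);
* source fields `un n y := δ_{σ n y}` for a section `σ n` of `baseB n` (`hσ`; for `H_k`: `σ y = (y, μ₀)`, the unit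
  source 1-form at the site y in a fixed direction μ₀ — the B_i = δ_{(y,μ)} of [I] (4.35)/(5.1)).

## What is PROVED here (kernel-checked; 0 sorry; no `def`)

(K1) `sum_fibre_exp_pl1_le` — the row sum of `e^{−a‖x − baseB b‖}` over a fibred point set is ≤ m·K₁(D, a)
(`B12Decay510Torus.sum_exp_pl1_le_K₁` + fibre count).
(K2) **`hasMaj_supSize_twoGrid_of_rowMajorant`** — [3] (2.51) ON THE TWO-GRID CARRIER: an ℝ-linear `T : (XB → ℂ) →
(XA → ℂ)` with the ROW MAJORANT `‖(TB)(p)‖ ≤ Σ_b C₁e^{−ρ‖baseA p − baseB b‖}‖B b‖` (periodic ℓ¹ distance of the unit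
torus, `ρ > 0`) has the block majorant `C₁·m·K₁(D, ρ∕2)·e^{−(ρ∕2)d₁(y,y′)}` between the sup sizes — half the rate
converts site distance into cube distance (`RemainderDecay190Periodised.tdist1_cubes_le_pl1`), the other half sums the
row (K1); `ineq190_supSize_twoGrid_of_rowMajorant` reads it as the (190) letter under `δ15 ≤ 4ρ`,
`C₁·m·K₁(D, ρ∕2) ≤ Cst`.  (The generic sibling in KERNEL form — `‖T(δ_b·v)(c)‖ ≤ κ(c,b)‖v‖` + block row sums ⟹ `HasMaj`
between sup sizes — is lit-balaban's `B11Ineq73HasMajConcrete.hasMaj_supSize_of_kernel`; here the ROW-MAJORANT form with the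
two-grid exponential kernel, its block row sums evaluated by (K1).)
(K3) THE DICTIONARY on the two-grid carrier, all three (T12) letters as theorems: `loc_supSize_single_le_one` (`hm`
with m = 1), `blk_eq_of_loc_supSize_single_ne_zero` + `unitFieldsLocalised_supSize_single` (`hD` under `0 ≤ θ`,
`θ·M ≤ 1`, for δ sources along any section σ of the fibration), `normDominated_supSize_restrict` (`hdom` for the
restriction-to-X̄ identification, via generation 94's coordinate reading `normDominated_pi_of_coord'`).
(K4) **`exists_data190_twoGrid_of_rowMajorant`** — THE SOCKET INHABITED: from a family `T n` with the row majorant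
(constants `C₁, ρ` uniform in n) and the NUMERICS `0 < q.σ`, `c₀(q.σ∕δr)^D ≤ q.cR` (some `δr > 0`), `1 ≤ q.κB`,
`q.δ15 ≤ 4ρ`, `C₁·m·K₁(D, ρ∕2) ≤ q.Cst`, `1 ≤ q.m`, `0 ≤ q.θ`, `q.θ·M ≤ 1`:
`∃ 𝒟 : Data190 D M N (fun n => XA n → ℂ) q` with the (4.35) test vector EXPOSED,
`𝒟.hn n X̄ y = (p ↦ cube(baseA p) ∈ X̄ ? (T n δ_{σ n y})(p) : 0)` (for NODE E's entrywise junction).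

## What is NOT claimed

* No operator of Bałaban's is constructed or estimated here: `T`, `XB`, `XA`, the fibrations and the section are
  parameters (the instance for the flat `H_k` is the successor file `RemainderDecay190TwoGridHk`); nothing printed is
  used as a hypothesis — the row majorant `hT` is the ONE analytic input, of the printed shape [3] (2.51).
* Only the n = 0 entry of (190) (values, sup size) is modelled: ONE local size for all indices i of the
  (4.4)-functional (the derivative ∕ Hölder ∕ Laplacian entries of (190) and of (4.4) are not separated on this carrier,
  exactly as on the same-torus model of generations 93–96).
* The identification of `T n δ_{σ y}` with [I]'s (δ/δB)𝐇_k(□₀,0)·B_i (the (4.35) representation `hrepr` of the chain) is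
  the business of the chain's NODE E ∕ B, untouched.  No `Literature` fact is minted; no `axiom`, no `sorry`.
  NOT summit progress, NOT the continuum limit, NOT Clay.
-/

namespace Literature.MathematicalPhysics.QuantumFieldTheory.Balaban1983to89.Beta.RemainderDecay190TwoGrid

open Literature.MathematicalPhysics.QuantumFieldTheory.Balaban1983to89 B11SectG B6RandomWalk
open Literature.MathematicalPhysics.QuantumFieldTheory.Balaban1983to89.B9Thm34Ext (toB6)
open Literature.MathematicalPhysics.QuantumFieldTheory.Balaban1983to89.B9Thm37GlueTorus (torusGeom tdist1 tdist1_nonneg)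
open Literature.MathematicalPhysics.QuantumFieldTheory.Balaban1983to89.B5TorusCover (UT)
open Literature.MathematicalPhysics.QuantumFieldTheory.Balaban1983to89.TreeLengthTorus (TPt TDom tsys)
open Literature.MathematicalPhysics.QuantumFieldTheory.Balaban1983to89.B12Decay510Window (K₁ K₁_nonneg)
open Literature.MathematicalPhysics.QuantumFieldTheory.Balaban1983to89.B12Decay510Torus
  (pl1 pl1_nonneg pl1_sub_comm tcubeOf geomT sum_exp_pl1_le_K₁)
open Literature.MathematicalPhysics.QuantumFieldTheory.Balaban1983to89.B12Decay510FromB11 (NormDominated UnitFieldsLocalised)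
open Literature.MathematicalPhysics.QuantumFieldTheory.Balaban1983to89.B11SupSize190
  (supNorm supNorm_nonneg norm_le_supNorm supNorm_le supSize supSize_loc supSize_isLoc_iff)
open Literature.MathematicalPhysics.QuantumFieldTheory.Balaban1983to89.Beta.RemainderDecay190 (Data190 Consts190)
open Literature.MathematicalPhysics.QuantumFieldTheory.Balaban1983to89.Beta.RemainderDecay190SectGTorus (hdist_torusGeom)
open Literature.MathematicalPhysics.QuantumFieldTheory.Balaban1983to89.Beta.RemainderRowSum (hrow_torusGeom)
open Literature.MathematicalPhysics.QuantumFieldTheory.Balaban1983to89.Beta.RemainderDecay190Dictionary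
  (pl1_le_tdist1_finOfVal distD_geomT_le_mul_pl1)
open Literature.MathematicalPhysics.QuantumFieldTheory.Balaban1983to89.Beta.RemainderDecay190SupNorm
  (normDominated_pi_of_coord')
open Literature.MathematicalPhysics.QuantumFieldTheory.Balaban1983to89.Beta.RemainderDecay190Periodised
  (tdist1_cubes_le_pl1)

noncomputable section

variable {D : ℕ}

/-! ## 1. The row sum over a fibred point set -/

section Fibre

variable {N Mc : ℕ} [NeZero N] [NeZero Mc] {XB : Type} [Fintype XB]

/-- **The row sum of the half-rate exponential over a point set fibred over the unit torus**: if every site of the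
torus carries at most m points of `XB` (`hm`), then `Σ_{b ∈ XB} e^{−a‖x − baseB b‖} ≤ m·K₁(D, a)` for `a > 0`, `‖·‖` the
periodic ℓ¹ distance — the start-site sum `B12Decay510Torus.sum_exp_pl1_le_K₁` (`K₁(D, a) = Σ_{z∈ℤ^D} e^{−a∣z∣₁}`)
counted fibre by fibre. [cite: Balaban1984PropagatorsII, Lemma 2.1 (2.61) p.234, count p.233] -/
theorem sum_fibre_exp_pl1_le (baseB : XB → TPt D (N * Mc)) (m : ℕ)
    (hm : ∀ y : TPt D (N * Mc), (Finset.univ.filter fun b : XB => baseB b = y).card ≤ m) {a : ℝ} (ha : 0 < a)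
    (x : TPt D (N * Mc)) :
    ∑ b : XB, Real.exp (-a * pl1 (x - baseB b)) ≤ m * K₁ D a := by
  classical
  have hfib : ∑ b : XB, Real.exp (-a * pl1 (x - baseB b)) =
      ∑ y : TPt D (N * Mc), ∑ b ∈ Finset.univ.filter (fun b : XB => baseB b = y),
        Real.exp (-a * pl1 (x - baseB b)) :=
    (Finset.sum_fiberwise Finset.univ baseB fun b => Real.exp (-a * pl1 (x - baseB b))).symm
  have hinner : ∀ y : TPt D (N * Mc),
      ∑ b ∈ Finset.univ.filter (fun b : XB => baseB b = y), Real.exp (-a * pl1 (x - baseB b)) ≤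
        (m : ℝ) * Real.exp (-a * pl1 (x - y)) := fun y => by
    have heq : ∑ b ∈ Finset.univ.filter (fun b : XB => baseB b = y), Real.exp (-a * pl1 (x - baseB b)) =
        ∑ b ∈ Finset.univ.filter (fun b : XB => baseB b = y), Real.exp (-a * pl1 (x - y)) :=
      Finset.sum_congr rfl fun b hb => by rw [(Finset.mem_filter.mp hb).2]
    rw [heq, Finset.sum_const, nsmul_eq_mul]
    exact mul_le_mul_of_nonneg_right (by exact_mod_cast hm y) (Real.exp_pos _).le
  have hsum : ∑ y : TPt D (N * Mc), Real.exp (-a * pl1 (x - y)) ≤ K₁ D a := by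
    have e : ∑ y : TPt D (N * Mc), Real.exp (-a * pl1 (x - y)) = ∑ w : TPt D (N * Mc), Real.exp (-a * pl1 w) :=
      Fintype.sum_equiv (Equiv.subLeft x) _ _ fun y => rfl
    rw [e]
    exact sum_exp_pl1_le_K₁ ha
  rw [hfib]
  calc ∑ y : TPt D (N * Mc), ∑ b ∈ Finset.univ.filter (fun b : XB => baseB b = y),
          Real.exp (-a * pl1 (x - baseB b))
        ≤ ∑ y : TPt D (N * Mc), (m : ℝ) * Real.exp (-a * pl1 (x - y)) := Finset.sum_le_sum fun y _ => hinner y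
    _ = (m : ℝ) * ∑ y : TPt D (N * Mc), Real.exp (-a * pl1 (x - y)) := by rw [Finset.mul_sum]
    _ ≤ (m : ℝ) * K₁ D a := mul_le_mul_of_nonneg_left hsum (Nat.cast_nonneg m)

end Fibre

/-! ## 2. [3] (2.51) on the two-grid carrier: a row majorant in the site distance ⟹ the (190) block majorant between
the sup sizes over the cubes -/

section Blocks

variable {N Mc : ℕ} [NeZero N] [NeZero Mc] {η L Mg R : ℝ} {H : Prop} {XB XA : Type} [Fintype XB] [Fintype XA]

/-- **ROW MAJORANT ⟹ THE (190) BLOCK MAJORANT, TWO GRIDS.**  On the cube torus (cubes of side `M` of the unit torus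
with `N·M` sites per direction, blocks read in `Π_i Fin N` through ê), let the B-data live on a finite point set `XB`
fibred over the unit torus by `baseB` (fibres of cardinality ≤ m) and the configurations on a finite point set `XA`
fibred by `baseA`; an ℝ-linear `T : (XB → ℂ) → (XA → ℂ)` with the row majorant
`‖(TB)(p)‖ ≤ Σ_b C₁e^{−ρ‖baseA p − baseB b‖}‖B b‖` (`ρ > 0`, `C₁ ≥ 0`) has the block majorant
`C₁·m·K₁(D, ρ∕2)·e^{−(ρ∕2)d₁(y,y′)}` between the sup sizes of (190) over the fibres of the cubes ([3] (2.51): *"|(Tλ)(x)|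
≤ K(y, y′)|λ|, x ∈ B(y), supp λ ⊂ B(y′)"*): half the rate converts site distance into cube distance
(`tdist1_cubes_le_pl1`), the other half sums the row over the fibred source points (§1).
[cite: Balaban1984PropagatorsII, (2.51) p.232, (2.46) p.231; Balaban1985Variational, (190) p.308; Balaban1984PropagatorsI, (1.6) p.18] -/
theorem hasMaj_supSize_twoGrid_of_rowMajorant (baseB : XB → TPt D (N * Mc)) (baseA : XA → TPt D (N * Mc))
    (m : ℕ) (hm : ∀ y : TPt D (N * Mc), (Finset.univ.filter fun b : XB => baseB b = y).card ≤ m)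
    (T : (XB → ℂ) →ₗ[ℝ] (XA → ℂ)) {C₁ ρ : ℝ} (hC₁ : 0 ≤ C₁) (hρ : 0 < ρ)
    (hT : ∀ (B : XB → ℂ) (p : XA),
      ‖T B p‖ ≤ ∑ b : XB, C₁ * Real.exp (-ρ * pl1 (baseA p - baseB b)) * ‖B b‖) :
    HasMaj
      (supSize (toB6 (torusGeom (fun _ : Fin D => N) η L Mg) R H)
        (fun y => Finset.univ.filter fun b : XB =>
          (fun i => (⟨(tcubeOf N Mc (baseB b) i).val, ZMod.val_lt (tcubeOf N Mc (baseB b) i)⟩ : Fin N)) = y)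
        (fun b : XB => fun i => (⟨(tcubeOf N Mc (baseB b) i).val, ZMod.val_lt (tcubeOf N Mc (baseB b) i)⟩ : Fin N)) :
        BlockNorm (toB6 (torusGeom (fun _ : Fin D => N) η L Mg) R H) (XB → ℂ))
      (supSize (toB6 (torusGeom (fun _ : Fin D => N) η L Mg) R H)
        (fun y => Finset.univ.filter fun p : XA =>
          (fun i => (⟨(tcubeOf N Mc (baseA p) i).val, ZMod.val_lt (tcubeOf N Mc (baseA p) i)⟩ : Fin N)) = y)
        (fun p : XA => fun i => (⟨(tcubeOf N Mc (baseA p) i).val, ZMod.val_lt (tcubeOf N Mc (baseA p) i)⟩ : Fin N)) :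
        BlockNorm (toB6 (torusGeom (fun _ : Fin D => N) η L Mg) R H) (XA → ℂ))
      T (fun y y' => C₁ * m * K₁ D (ρ / 2) * Real.exp (-(ρ / 2 * tdist1 (fun _ : Fin D => N) y y'))) := by
  classical
  have hρ2 : 0 < ρ / 2 := by linarith
  have hK₁ : 0 ≤ K₁ D (ρ / 2) := K₁_nonneg D _
  intro y' B hB y
  rw [supSize_isLoc_iff] at hB
  rw [supSize_loc, supSize_loc]
  set S := supNorm (Finset.univ.filter fun b : XB =>
      (fun i => (⟨(tcubeOf N Mc (baseB b) i).val, ZMod.val_lt (tcubeOf N Mc (baseB b) i)⟩ : Fin N)) = y') B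
    with hS_def
  have hS : 0 ≤ S := supNorm_nonneg _ _
  have hKS : 0 ≤ C₁ * m * K₁ D (ρ / 2) * Real.exp (-(ρ / 2 * tdist1 (fun _ : Fin D => N) y y')) * S :=
    mul_nonneg (mul_nonneg (mul_nonneg (mul_nonneg hC₁ (Nat.cast_nonneg m)) hK₁) (Real.exp_pos _).le) hS
  refine supNorm_le hKS fun p hp => ?_
  have hpy : (fun i => (⟨(tcubeOf N Mc (baseA p) i).val, ZMod.val_lt (tcubeOf N Mc (baseA p) i)⟩ : Fin N)) = y :=
    (Finset.mem_filter.mp hp).2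
  -- each entry of the row at p: only the source block y′ contributes, split into two half-rate factors
  have hterm : ∀ b : XB, C₁ * Real.exp (-ρ * pl1 (baseA p - baseB b)) * ‖B b‖ ≤
      C₁ * Real.exp (-(ρ / 2 * tdist1 (fun _ : Fin D => N) y y')) * S *
        Real.exp (-(ρ / 2) * pl1 (baseA p - baseB b)) := fun b => by
    by_cases hb : (fun i => (⟨(tcubeOf N Mc (baseB b) i).val, ZMod.val_lt (tcubeOf N Mc (baseB b) i)⟩ : Fin N)) = y'
    · have h2 : ‖B b‖ ≤ S := norm_le_supNorm B (Finset.mem_filter.mpr ⟨Finset.mem_univ b, hb⟩)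
      have hsplit : C₁ * Real.exp (-ρ * pl1 (baseA p - baseB b)) ≤
          C₁ * Real.exp (-(ρ / 2 * tdist1 (fun _ : Fin D => N) y y')) *
            Real.exp (-(ρ / 2) * pl1 (baseA p - baseB b)) := by
        rw [mul_assoc, ← Real.exp_add]
        refine mul_le_mul_of_nonneg_left (Real.exp_le_exp.mpr ?_) hC₁
        have hd := tdist1_cubes_le_pl1 (N := N) (M := Mc) (baseA p) (baseB b)
        rw [hpy, hb] at hd
        nlinarith [hd, pl1_nonneg (baseA p - baseB b)]
      calc C₁ * Real.exp (-ρ * pl1 (baseA p - baseB b)) * ‖B b‖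
          ≤ (C₁ * Real.exp (-(ρ / 2 * tdist1 (fun _ : Fin D => N) y y')) *
              Real.exp (-(ρ / 2) * pl1 (baseA p - baseB b))) * S :=
            mul_le_mul hsplit h2 (norm_nonneg _)
              (mul_nonneg (mul_nonneg hC₁ (Real.exp_pos _).le) (Real.exp_pos _).le)
        _ = _ := by ring
    · rw [hB b hb, norm_zero, mul_zero]
      exact mul_nonneg (mul_nonneg (mul_nonneg hC₁ (Real.exp_pos _).le) hS) (Real.exp_pos _).le
  have hsum := sum_fibre_exp_pl1_le baseB m hm hρ2 (baseA p)
  calc ‖T B p‖ ≤ ∑ b : XB, C₁ * Real.exp (-ρ * pl1 (baseA p - baseB b)) * ‖B b‖ := hT B p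
    _ ≤ ∑ b : XB, C₁ * Real.exp (-(ρ / 2 * tdist1 (fun _ : Fin D => N) y y')) * S *
          Real.exp (-(ρ / 2) * pl1 (baseA p - baseB b)) := Finset.sum_le_sum fun b _ => hterm b
    _ = C₁ * Real.exp (-(ρ / 2 * tdist1 (fun _ : Fin D => N) y y')) * S *
          ∑ b : XB, Real.exp (-(ρ / 2) * pl1 (baseA p - baseB b)) := by rw [Finset.mul_sum]
    _ ≤ C₁ * Real.exp (-(ρ / 2 * tdist1 (fun _ : Fin D => N) y y')) * S * (m * K₁ D (ρ / 2)) :=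
        mul_le_mul_of_nonneg_left hsum (mul_nonneg (mul_nonneg hC₁ (Real.exp_pos _).le) hS)
    _ = C₁ * m * K₁ D (ρ / 2) * Real.exp (-(ρ / 2 * tdist1 (fun _ : Fin D => N) y y')) * S := by ring

/-- **… READ AS THE (190) LETTER**: with `δ15 ≤ 4ρ` and `C₁·m·K₁(D, ρ∕2) ≤ Cst` the block majorant of
`hasMaj_supSize_twoGrid_of_rowMajorant` is an `Ineq190 … Cst δ15` (majorant `Cst·e^{−⅛δ15·d₁(y,y′)}`) between the sup
sizes of the two grids — the type of `Data190.h190` on the two-grid carrier. [cite: Balaban1985Variational, (190) p.308] -/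
theorem ineq190_supSize_twoGrid_of_rowMajorant (baseB : XB → TPt D (N * Mc)) (baseA : XA → TPt D (N * Mc))
    (m : ℕ) (hm : ∀ y : TPt D (N * Mc), (Finset.univ.filter fun b : XB => baseB b = y).card ≤ m)
    (T : (XB → ℂ) →ₗ[ℝ] (XA → ℂ)) {C₁ ρ Cst δ15 : ℝ} (hC₁ : 0 ≤ C₁) (hρ : 0 < ρ)
    (hT : ∀ (B : XB → ℂ) (p : XA),
      ‖T B p‖ ≤ ∑ b : XB, C₁ * Real.exp (-ρ * pl1 (baseA p - baseB b)) * ‖B b‖)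
    (hδ15 : δ15 ≤ 4 * ρ) (hCst : C₁ * m * K₁ D (ρ / 2) ≤ Cst) :
    Ineq190
      (supSize (toB6 (torusGeom (fun _ : Fin D => N) η L Mg) R H)
        (fun y => Finset.univ.filter fun b : XB =>
          (fun i => (⟨(tcubeOf N Mc (baseB b) i).val, ZMod.val_lt (tcubeOf N Mc (baseB b) i)⟩ : Fin N)) = y)
        (fun b : XB => fun i => (⟨(tcubeOf N Mc (baseB b) i).val, ZMod.val_lt (tcubeOf N Mc (baseB b) i)⟩ : Fin N)) :
        BlockNorm (toB6 (torusGeom (fun _ : Fin D => N) η L Mg) R H) (XB → ℂ))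
      (supSize (toB6 (torusGeom (fun _ : Fin D => N) η L Mg) R H)
        (fun y => Finset.univ.filter fun p : XA =>
          (fun i => (⟨(tcubeOf N Mc (baseA p) i).val, ZMod.val_lt (tcubeOf N Mc (baseA p) i)⟩ : Fin N)) = y)
        (fun p : XA => fun i => (⟨(tcubeOf N Mc (baseA p) i).val, ZMod.val_lt (tcubeOf N Mc (baseA p) i)⟩ : Fin N)) :
        BlockNorm (toB6 (torusGeom (fun _ : Fin D => N) η L Mg) R H) (XA → ℂ))
      T Cst δ15 := by
  refine (hasMaj_supSize_twoGrid_of_rowMajorant (η := η) (L := L) (Mg := Mg) (R := R) (H := H) baseB baseA m hm T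
    hC₁ hρ hT).mono fun y y' => ?_
  have hd : 0 ≤ tdist1 (fun _ : Fin D => N) y y' := tdist1_nonneg y y'
  have hK₁ : 0 ≤ K₁ D (ρ / 2) := K₁_nonneg D _
  show C₁ * m * K₁ D (ρ / 2) * Real.exp (-(ρ / 2 * tdist1 (fun _ : Fin D => N) y y')) ≤
    Cst * Real.exp (-(δ15 / 8 * (toB6 (torusGeom (fun _ : Fin D => N) η L Mg) R H).dist y y'))
  have hdist : (toB6 (torusGeom (fun _ : Fin D => N) η L Mg) R H).dist y y' = tdist1 (fun _ : Fin D => N) y y' := rfl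
  rw [hdist]
  exact mul_le_mul hCst (Real.exp_le_exp.mpr (by nlinarith)) (Real.exp_pos _).le
    ((mul_nonneg (mul_nonneg hC₁ (Nat.cast_nonneg m)) hK₁).trans hCst)

end Blocks

/-! ## 3. The (4.4)-dictionary on the two-grid carrier: all three (T12) letters as theorems -/

section Dictionary

variable {g : B6.Geometry} [DecidableEq g.Site] {X : Type} [DecidableEq X] {box : g.Site → Finset X}
  {blk : X → g.Site}

omit [DecidableEq g.Site] in
/-- **`hm` with m = 1 for the sup size**: the size at y′ of a δ source `δ_{b₀}` (`Pi.single b₀ 1`, complex values) is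
≤ 1 at every block. [cite: Balaban1987RG1, p.282] -/
theorem loc_supSize_single_le_one (b₀ : X) (y' : g.Site) :
    (supSize g box blk : BlockNorm g (X → ℂ)).loc y' (Pi.single b₀ (1 : ℂ)) ≤ 1 := by
  rw [supSize_loc]
  refine supNorm_le zero_le_one fun b _ => ?_
  by_cases hb : b = b₀
  · subst hb; rw [Pi.single_eq_same, norm_one]
  · rw [Pi.single_eq_of_ne hb, norm_zero]; exact zero_le_one

/-- With the box of y′ = the fibre of the block map over y′, a non-zero sup size of `δ_{b₀}` at y′ LOCATES the block:
`blk b₀ = y′` (elementary; locus = the block localisation *"supp 𝔄 ⊂ Δ̃(y′)"* of (189)–(190)).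
[cite: Balaban1985Variational, (189)-(190) p.308] -/
theorem blk_eq_of_loc_supSize_single_ne_zero [Fintype X] {b₀ : X} {y' : g.Site}
    (h : (supSize g (fun y => Finset.univ.filter fun b : X => blk b = y) blk : BlockNorm g (X → ℂ)).loc y'
      (Pi.single b₀ (1 : ℂ)) ≠ 0) : blk b₀ = y' := by
  by_contra hne
  apply h
  rw [supSize_loc]
  refine le_antisymm (supNorm_le le_rfl fun b hb => ?_) (supNorm_nonneg _ _)
  have hby : blk b = y' := (Finset.mem_filter.mp hb).2
  have hbb : b ≠ b₀ := fun e => hne (e ▸ hby)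
  rw [Pi.single_eq_of_ne hbb, norm_zero]

end Dictionary

section Localised

variable {N Mc : ℕ} [NeZero N] [NeZero Mc] {η L Mg R : ℝ} {H : Prop} {XB : Type} [Fintype XB] [DecidableEq XB]

/-- **`Data190.hD` ON THE TWO-GRID CARRIER** ([I] p. 282 *"the additional exponential factor
exp(−δ₀dist^{(ξ)}(X, supp B_i))"* in the block vocabulary of [15] (190) ∕ [3] (2.46)): B-data on `XB` fibred over the
unit cube-torus by `baseB`, sup sizes over the fibres of the cubes, blocks meeting X̄ := ê''(cubes of X̄), δ source
fields along a SECTION σ of the fibration (`baseB (σ y) = y`), any `0 ≤ θ` with `θ·M ≤ 1`: the B-size of `δ_{σ x}` is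
non-zero only at the block ê(cube x), and for every cube c of X̄ `θ·dist(x, X̄) ≤ θ·M·∣cube x − c∣ ≤ d₁(ê c, ê(cube x))`
(generation 93 `distD_geomT_le_mul_pl1` + the isometry ê). [cite: Balaban1987RG1, p.282; Balaban1984PropagatorsII, (2.46) p.231] -/
theorem unitFieldsLocalised_supSize_single (baseB : XB → TPt D (N * Mc)) (σ : TPt D (N * Mc) → XB)
    (hσ : ∀ y, baseB (σ y) = y) {θ : ℝ} (hθ : 0 ≤ θ) (hθM : θ * Mc ≤ 1) :
    UnitFieldsLocalised
      (supSize (toB6 (torusGeom (fun _ : Fin D => N) η L Mg) R H)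
        (fun y => Finset.univ.filter fun b : XB =>
          (fun i => (⟨(tcubeOf N Mc (baseB b) i).val, ZMod.val_lt (tcubeOf N Mc (baseB b) i)⟩ : Fin N)) = y)
        (fun b : XB => fun i => (⟨(tcubeOf N Mc (baseB b) i).val, ZMod.val_lt (tcubeOf N Mc (baseB b) i)⟩ : Fin N)) :
        BlockNorm (toB6 (torusGeom (fun _ : Fin D => N) η L Mg) R H) (XB → ℂ))
      (geomT D N Mc)
      (fun X : TDom D N =>
        (X.1.image fun a : TPt D N => fun i => (⟨(a i).val, ZMod.val_lt (a i)⟩ : Fin N) :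
          Finset (UT (fun _ : Fin D => N))))
      (fun x => Pi.single (σ x) (1 : ℂ)) θ := by
  -- typeclass synthesis does not unfold `toB6`: name the block torus's decidable equality on `g.Site`
  letI : DecidableEq (toB6 (torusGeom (fun _ : Fin D => N) η L Mg) R H).Site :=
    inferInstanceAs (DecidableEq (UT (fun _ : Fin D => N)))
  intro X x y hy y' hne
  have hy' : (fun i => (⟨(tcubeOf N Mc (baseB (σ x)) i).val, ZMod.val_lt (tcubeOf N Mc (baseB (σ x)) i)⟩ : Fin N))
      = y' :=
    blk_eq_of_loc_supSize_single_ne_zero (g := toB6 (torusGeom (fun _ : Fin D => N) η L Mg) R H)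
      (blk := fun b : XB => fun i =>
        (⟨(tcubeOf N Mc (baseB b) i).val, ZMod.val_lt (tcubeOf N Mc (baseB b) i)⟩ : Fin N)) hne
  rw [hσ x] at hy'
  obtain ⟨c, hc, rfl⟩ := Finset.mem_image.mp hy
  rw [← hy']
  show θ * (geomT D N Mc).distD x X ≤ tdist1 (fun _ : Fin D => N)
    (fun i => (⟨(c i).val, ZMod.val_lt (c i)⟩ : Fin N))
    (fun i => (⟨(tcubeOf N Mc x i).val, ZMod.val_lt (tcubeOf N Mc x i)⟩ : Fin N))
  have h1 : (geomT D N Mc).distD x X ≤ (Mc : ℝ) * pl1 (tcubeOf N Mc x - c) := distD_geomT_le_mul_pl1 x X hc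
  have h2 : pl1 (tcubeOf N Mc x - c) ≤ tdist1 (fun _ : Fin D => N)
      (fun i => (⟨(c i).val, ZMod.val_lt (c i)⟩ : Fin N))
      (fun i => (⟨(tcubeOf N Mc x i).val, ZMod.val_lt (tcubeOf N Mc x i)⟩ : Fin N)) := by
    rw [pl1_sub_comm]; exact pl1_le_tdist1_finOfVal c _
  calc θ * (geomT D N Mc).distD x X ≤ θ * ((Mc : ℝ) * pl1 (tcubeOf N Mc x - c)) :=
        mul_le_mul_of_nonneg_left h1 hθ
    _ = (θ * Mc) * pl1 (tcubeOf N Mc x - c) := by ring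
    _ ≤ 1 * pl1 (tcubeOf N Mc x - c) := mul_le_mul_of_nonneg_right hθM (pl1_nonneg _)
    _ ≤ _ := by rw [one_mul]; exact h2

end Localised

section Dominated

variable {N Mc : ℕ} [NeZero N] [NeZero Mc] {η L Mg R : ℝ} {H : Prop} {XA : Type} [Fintype XA] {I : Type}

/-- **`Data190.hdom` ON THE TWO-GRID CARRIER**: configurations on `XA` fibred over the unit cube-torus by `baseA`, the
sup size over the fibres of the cubes for EVERY index i of the (4.4)-functional, (4.4)-space `XA → ℂ` with the sup norm,
identification ι_X̄ := restriction to the configuration points over the cubes of X̄: the (4.4)-norm of X̄ is dominated by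
the local sizes over the blocks ê''(cubes of X̄) (generation 94's coordinate reading `normDominated_pi_of_coord'`: a
point over a cube of X̄ is read by the size of its own block, which meets X̄; a point elsewhere reads 0).
[cite: Balaban1987RG1, (4.4) p.281; Balaban1985Variational, (190) p.308] -/
theorem normDominated_supSize_restrict (baseA : XA → TPt D (N * Mc)) (i₀ : I) :
    NormDominated (S := tsys D N)
      (fun _ : I => (supSize (toB6 (torusGeom (fun _ : Fin D => N) η L Mg) R H)
        (fun y => Finset.univ.filter fun p : XA =>
          (fun i => (⟨(tcubeOf N Mc (baseA p) i).val, ZMod.val_lt (tcubeOf N Mc (baseA p) i)⟩ : Fin N)) = y)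
        (fun p : XA => fun i => (⟨(tcubeOf N Mc (baseA p) i).val, ZMod.val_lt (tcubeOf N Mc (baseA p) i)⟩ : Fin N)) :
        BlockNorm (toB6 (torusGeom (fun _ : Fin D => N) η L Mg) R H) (XA → ℂ)))
      (fun X : TDom D N =>
        (X.1.image fun a : TPt D N => fun i => (⟨(a i).val, ZMod.val_lt (a i)⟩ : Fin N) :
          Finset (UT (fun _ : Fin D => N))))
      (V := fun _ => XA → ℂ)
      (fun (X : TDom D N) (A : XA → ℂ) (p : XA) => if tcubeOf N Mc (baseA p) ∈ X.1 then A p else 0) := by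
  -- typeclass synthesis does not unfold `toB6`: name the block torus's decidable equality on `g.Site`
  letI : DecidableEq (toB6 (torusGeom (fun _ : Fin D => N) η L Mg) R H).Site :=
    inferInstanceAs (DecidableEq (UT (fun _ : Fin D => N)))
  refine normDominated_pi_of_coord' (S := tsys D N) _ _ _ (fun (X : TDom D N) (p : XA) => tcubeOf N Mc (baseA p) ∈ X.1)
    (fun X A p hp => if_neg hp) fun X p hp => ?_
  refine ⟨i₀, fun i => (⟨(tcubeOf N Mc (baseA p) i).val, ZMod.val_lt (tcubeOf N Mc (baseA p) i)⟩ : Fin N),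
    Finset.mem_image_of_mem _ hp, fun A => ?_⟩
  show ‖(if tcubeOf N Mc (baseA p) ∈ X.1 then A p else 0)‖ ≤ _
  rw [if_pos hp, supSize_loc]
  exact norm_le_supNorm A (Finset.mem_filter.mpr ⟨Finset.mem_univ p, rfl⟩)

end Dominated

/-! ## 4. THE (190)-SOCKET ON THE TWO-GRID CARRIER from one row-majorant statement -/

section Socket

variable {Mc : ℕ} [NeZero Mc] {N : ℕ → ℕ} [∀ n, NeZero (N n)] {q : Consts190}

/-- **JOIN CERTIFICATE ON THE TWO-GRID CARRIER.**  For every volume index n let the B-data live on a finite point set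
`XB n` fibred over the unit cube-torus `TPt D (N n·M)` by `baseB n` (fibres of cardinality ≤ m; section `σ n`), the
configurations on a finite point set `XA n` fibred by `baseA n`, and let `T n : (XB n → ℂ) →ₗ[ℝ] (XA n → ℂ)` have the
ROW MAJORANT `‖(T n B)(p)‖ ≤ Σ_b C₁e^{−ρ‖baseA n p − baseB n b‖}‖B b‖` with `C₁ ≥ 0`, `ρ > 0` UNIFORM IN n.  Under the
NUMERICS `0 < q.σ`, a row-sum reference rate `δr > 0` with `c₀(q.σ∕δr)^D ≤ q.cR` ([3] (2.61)), `1 ≤ q.κB`,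
`q.δ15 ≤ 4ρ`, `C₁·m·K₁(D, ρ∕2) ≤ q.Cst`, `1 ≤ q.m`, `0 ≤ q.θ`, `q.θ·M ≤ 1`, the (190)-socket
`Data190 D M N (fun n => XA n → ℂ) q` of the k-uniform remainder chain is INHABITED on the carrier of the module
docstring (block torus ê(cube torus), sup sizes over the fibres of the cubes on both grids, (4.4)-space `XA n → ℂ` with
the sup norm, identification = restriction to the points over the cubes of X̄, blocks meeting X̄ = ê''(cubes of X̄), δ
sources along σ), with the (4.35) test vector EXPOSED: `𝒟.hn n X̄ y = (p ↦ cube(baseA n p) ∈ X̄ ? (T n δ_{σ n y})(p) : 0)`.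
`h190` by §2; `hdist` ∕ `hrow` by `hdist_torusGeom` ∕ `hrow_torusGeom`; `hdom` ∕ `hm` ∕ `hD` by §3.  Nothing of
Bałaban's is constructed: `T`, the point sets, the fibrations are parameters.
[cite: Balaban1985Variational, (190) p.308; Balaban1987RG1, (4.4) p.281 and p.282; Balaban1984PropagatorsII, (2.46) p.231, (2.51) p.232, (2.61) p.234; Balaban1984PropagatorsI, (1.6) p.18] -/
theorem exists_data190_twoGrid_of_rowMajorant (I : Type) (i₀ : I) (η L Mg R : ℕ → ℝ) (H : ℕ → Prop)
    (XB XA : ℕ → Type) [∀ n, Fintype (XB n)] [∀ n, Fintype (XA n)] [∀ n, DecidableEq (XB n)]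
    (baseB : (n : ℕ) → XB n → TPt D (N n * Mc)) (baseA : (n : ℕ) → XA n → TPt D (N n * Mc))
    (σ : (n : ℕ) → TPt D (N n * Mc) → XB n) (hσ : ∀ n y, baseB n (σ n y) = y)
    (m : ℕ) (hm : ∀ n (y : TPt D (N n * Mc)), (Finset.univ.filter fun b : XB n => baseB n b = y).card ≤ m)
    (T : (n : ℕ) → (XB n → ℂ) →ₗ[ℝ] (XA n → ℂ)) {C₁ ρ δr : ℝ} (hC₁ : 0 ≤ C₁) (hρ : 0 < ρ)
    (hT : ∀ n (B : XB n → ℂ) (p : XA n),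
      ‖T n B p‖ ≤ ∑ b : XB n, C₁ * Real.exp (-ρ * pl1 (baseA n p - baseB n b)) * ‖B b‖)
    (hδr : 0 < δr) (hσ₀ : 0 < q.σ) (hcR : B6.c0 δr (q.σ / δr) ^ D ≤ q.cR) (hκB : 1 ≤ q.κB)
    (hδ15 : q.δ15 ≤ 4 * ρ) (hCst : C₁ * m * K₁ D (ρ / 2) ≤ q.Cst) (hm1 : 1 ≤ q.m) (hθ : 0 ≤ q.θ)
    (hθM : q.θ * Mc ≤ 1) :
    ∃ 𝒟 : Data190 D Mc N (fun n => XA n → ℂ) q,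
      ∀ (n : ℕ) (X : TDom D (N n)) (y : TPt D (N n * Mc)),
        𝒟.hn n X y = fun p : XA n =>
          if tcubeOf (N n) Mc (baseA n p) ∈ X.1 then T n (Pi.single (σ n y) (1 : ℂ)) p else 0 :=
  ⟨{ I := I, gn := fun n => toB6 (torusGeom (fun _ : Fin D => N n) (η n) (L n) (Mg n)) (R n) (H n),
     FBn := fun n => XB n → ℂ, FAn := fun n => XA n → ℂ,
     bBn := fun n => (supSize (toB6 (torusGeom (fun _ : Fin D => N n) (η n) (L n) (Mg n)) (R n) (H n))
       (fun y => Finset.univ.filter fun b : XB n =>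
         (fun i => (⟨(tcubeOf (N n) Mc (baseB n b) i).val, ZMod.val_lt (tcubeOf (N n) Mc (baseB n b) i)⟩ :
           Fin (N n))) = y)
       (fun b : XB n => fun i =>
         (⟨(tcubeOf (N n) Mc (baseB n b) i).val, ZMod.val_lt (tcubeOf (N n) Mc (baseB n b) i)⟩ : Fin (N n))) :
       BlockNorm (toB6 (torusGeom (fun _ : Fin D => N n) (η n) (L n) (Mg n)) (R n) (H n)) (XB n → ℂ)),
     boutn := fun n _ => (supSize (toB6 (torusGeom (fun _ : Fin D => N n) (η n) (L n) (Mg n)) (R n) (H n))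
       (fun y => Finset.univ.filter fun p : XA n =>
         (fun i => (⟨(tcubeOf (N n) Mc (baseA n p) i).val, ZMod.val_lt (tcubeOf (N n) Mc (baseA n p) i)⟩ :
           Fin (N n))) = y)
       (fun p : XA n => fun i =>
         (⟨(tcubeOf (N n) Mc (baseA n p) i).val, ZMod.val_lt (tcubeOf (N n) Mc (baseA n p) i)⟩ : Fin (N n))) :
       BlockNorm (toB6 (torusGeom (fun _ : Fin D => N n) (η n) (L n) (Mg n)) (R n) (H n)) (XA n → ℂ)),
     dHn := T,
     blkn := fun n X => (X.1.image fun a : TPt D (N n) => fun i => (⟨(a i).val, ZMod.val_lt (a i)⟩ : Fin (N n)) :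
       Finset (UT (fun _ : Fin D => N n))),
     ιn := fun n X A p => if tcubeOf (N n) Mc (baseA n p) ∈ X.1 then A p else 0,
     un := fun n y => Pi.single (σ n y) (1 : ℂ),
     h190 := fun n _ => ineq190_supSize_twoGrid_of_rowMajorant (baseB n) (baseA n) m (hm n) (T n) hC₁ hρ (hT n)
       hδ15 hCst,
     hdist := hdist_torusGeom (fun n (_ : Fin D) => N n) η L Mg R H,
     hrow := hrow_torusGeom (fun n (_ : Fin D) => N n) η L Mg R H hδr hσ₀ hcR,
     hκB := fun _ => hκB,
     hdom := fun n => normDominated_supSize_restrict (baseA n) i₀,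
     hm := fun n y y' => (loc_supSize_single_le_one
       (g := toB6 (torusGeom (fun _ : Fin D => N n) (η n) (L n) (Mg n)) (R n) (H n)) (σ n y) y').trans hm1,
     hD := fun n => unitFieldsLocalised_supSize_single (baseB n) (σ n) (hσ n) hθ hθM },
    fun _ _ _ => rfl⟩

end Socket

end

end Literature.MathematicalPhysics.QuantumFieldTheory.Balaban1983to89.Beta.RemainderDecay190TwoGrid
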